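import Literature.Algebra.Homology.OrderedCechPairSystem
import Mathlib.Algebra.Homology.TotalComplex
import Mathlib.Algebra.Homology.Embedding.CochainComplex
import HarnessLib

/-!
# Degree bounds for the ordered Čech bicomplex of a pair-system and its total complex (Stacks 0BEC, 012Z)

Layer `Literature/Algebra/Homology` (proved lemmas only; 0 `def`, 0 named facts, no instance, no notation; pure homological
algebra over a commutative ring `A`). Sequel to `Algebra/Homology/OrderedCechPairSystem`: for linearly ordered `ι`, `κ` and a
pair-system `P : Finset ι ⥤ Finset κ ⥤ ModuleCat A`, the ordered Čech bicomplex `Č•,•(P) = sysBicomplex P`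
(`Čᵃ,ᵇ(P) = Π_{τ ∈ Simplex κ b} Π_{σ ∈ Simplex ι a} P σ τ`) is a first-quadrant bicomplex of finite size:
* `isZero_sysBicomplex_X_X_of_neg_right` / `_of_card_le_right` (`b < 0` or `#κ ≤ b`: the column is the ordered Čech complex of
  `cochainSystem P a` — `isZero_sysComplex_X_of_neg` / `_of_card_le`, Görtz–Wedhorn II Cor. 21.70), `_of_neg_left` /
  `_of_card_le_left` (`a < 0` or `#ι ≤ a`: no `a`-simplices), whole columns `isZero_sysBicomplex_X_of_neg` / `_of_card_le`;
* amplitudes in Mathlib's language (`CochainComplex.IsStrictlyGE` / `IsStrictlyLE`): columns `isStrictlyGE_sysBicomplex_X` (`≥ 0`),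
  `isStrictlyLE_sysBicomplex_X` (`≤ #κ - 1`); complex of columns `isStrictlyGE_sysBicomplex` (`≥ 0`), `isStrictlyLE_sysBicomplex`
  (`≤ #ι - 1`);
* the TOTAL complex (Stacks 012Z, Weibel 1.2.6): the generic criterion `isZero_total_X_of_isZero_X_X` («`Tot(K)ⁿ = 0` if `Kᵃ,ᵇ = 0`
  whenever `a + b = n`», any preadditive category; the tree's `TotalQuasiIsoOfColumns.isZero_total_X_of_isZero_X` asks for zero
  COLUMNS — a different statement), **`isStrictlyGE_sysBicomplex_total`** (`≥ 0`) and **`isStrictlyLE_sysBicomplex_total`**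
  (`≤ #ι + #κ - 2`) — the boundedness hypotheses of the quasi-isomorphism criteria of `Algebra/Homology/TotalQuasiIsoOfBoundedColumns`
  (weaker bounds follow by Mathlib's `CochainComplex.isStrictlyLE_of_le` / `isStrictlyGE_of_ge`).

Everything applies verbatim to `Modules.cechBoxBicomplex` (`Modules/CechBoxTensorBicomplex`, an `abbrev` of `sysBicomplex`). Library
only (cell `pub-hodge-ring2`, count-neutral); proves nothing about any crux, route or conjecture. Mathlib searched (pin v4.32):
`CochainComplex.isStrictlyGE_iff` / `isStrictlyLE_iff`, `HomologicalComplex₂.total.hom_ext`, `IsZero.iff_id_eq_zero`,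
`ModuleCat.isZero_of_subsingleton` (used); no bicomplex-amplitude lemma of this shape.

## References

* The Stacks Project, Tag 0BEC (Künneth: the double Čech complex), Tag 012Z (total complex), Tag 01FG. [StacksProject]
* C. A. Weibel, *An introduction to homological algebra* (1994), 1.2.6 (total complexes; boundedness). [Weibel1994]
* U. Görtz, T. Wedhorn, *Algebraic Geometry II* (2023), Def. 21.68, Cor. 21.70 (pp. 180–181). [GortzWedhorn2023]
-/

universe v' u' u

open CategoryTheory CategoryTheory.Limits

set_option backward.isDefEq.respectTransparency false

namespace Literature.Algebra.Homology

/-! ### §1 A vanishing criterion for the terms of a total complex -/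

section Total

variable {C : Type u'} [Category.{v'} C] [Preadditive C]
  (K : HomologicalComplex₂ C (ComplexShape.up ℤ) (ComplexShape.up ℤ)) [K.HasTotal (ComplexShape.up ℤ)]

/-- **`Tot(K)ⁿ = 0` as soon as `Kᵃ,ᵇ = 0` for all `a + b = n`** (the total complex in degree `n` is the coproduct of the
`Kᵃ,ᵇ`, `a + b = n`; a coproduct of zero objects is zero — checked on the injections `ιTotal`).
[cite: StacksProject, Tag 012Z] [cite: Weibel1994, 1.2.6] -/
theorem isZero_total_X_of_isZero_X_X (n : ℤ) (h : ∀ a b : ℤ, a + b = n → IsZero ((K.X a).X b)) :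
    IsZero ((K.total (ComplexShape.up ℤ)).X n) := by
  rw [IsZero.iff_id_eq_zero]
  exact HomologicalComplex₂.total.hom_ext _ fun a b hab => (h a b hab).eq_of_src _ _

end Total

namespace OrderedCech

variable {A : Type u} [CommRing A] {ι κ : Type} [LinearOrder ι] [LinearOrder κ]
  (P : Finset ι ⥤ Finset κ ⥤ ModuleCat.{u} A)

/-! ### §2 Vanishing of the terms `Čᵃ,ᵇ(P)` outside `[0, #ι - 1] × [0, #κ - 1]` -/

/-- `Čᵃ,ᵇ(P) = 0` for `b < 0` (no `b`-simplices in `κ`). [cite: GortzWedhorn2023, Def. 21.68 (p. 180)] -/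
theorem isZero_sysBicomplex_X_X_of_neg_right (a b : ℤ) (hb : b < 0) : IsZero (((sysBicomplex P).X a).X b) :=
  isZero_sysComplex_X_of_neg (cochainSystem P a) b hb

/-- `Čᵃ,ᵇ(P) = 0` for `#κ ≤ b` (no `b`-simplices in the finite type `κ`). [cite: GortzWedhorn2023, Cor. 21.70 (p. 181)] -/
theorem isZero_sysBicomplex_X_X_of_card_le_right [Fintype κ] (a b : ℤ) (hb : (Fintype.card κ : ℤ) ≤ b) :
    IsZero (((sysBicomplex P).X a).X b) :=
  isZero_sysComplex_X_of_card_le (cochainSystem P a) b hb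

/-- If `ι` has no `a`-simplices, the cochain modules `Čᵃ,ᵇ(P) = Π_τ Čᵃ(P(·, τ))` have one element.
[cite: GortzWedhorn2023, Def. 21.68 (p. 180)] -/
theorem subsingleton_sysCochain_cochainSystem {a : ℤ} [IsEmpty (Simplex ι a)] (b : ℤ) :
    Subsingleton (SysCochain (cochainSystem P a) b) :=
  ⟨fun f g => funext fun τ => Subsingleton.elim (α := SysCochain (P.flip.obj τ.1) a) (f τ) (g τ)⟩

/-- `Čᵃ,ᵇ(P) = 0` for `a < 0` (no `a`-simplices in `ι`). [cite: GortzWedhorn2023, Def. 21.68 (p. 180)] -/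
theorem isZero_sysBicomplex_X_X_of_neg_left (a b : ℤ) (ha : a < 0) : IsZero (((sysBicomplex P).X a).X b) := by
  haveI : IsEmpty (Simplex ι a) := isEmpty_simplex_of_neg ha
  haveI := subsingleton_sysCochain_cochainSystem P (a := a) b
  change IsZero (ModuleCat.of A (SysCochain (cochainSystem P a) b))
  exact ModuleCat.isZero_of_subsingleton _

/-- `Čᵃ,ᵇ(P) = 0` for `#ι ≤ a` (no `a`-simplices in the finite type `ι`). [cite: GortzWedhorn2023, Cor. 21.70 (p. 181)] -/
theorem isZero_sysBicomplex_X_X_of_card_le_left [Fintype ι] (a b : ℤ) (ha : (Fintype.card ι : ℤ) ≤ a) :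
    IsZero (((sysBicomplex P).X a).X b) := by
  haveI : IsEmpty (Simplex ι a) := isEmpty_simplex_of_card_le ha
  haveI := subsingleton_sysCochain_cochainSystem P (a := a) b
  change IsZero (ModuleCat.of A (SysCochain (cochainSystem P a) b))
  exact ModuleCat.isZero_of_subsingleton _

/-- The whole column `Čᵃ,•(P)` is a zero complex for `a < 0`. [cite: GortzWedhorn2023, Def. 21.68 (p. 180)] -/
theorem isZero_sysBicomplex_X_of_neg (a : ℤ) (ha : a < 0) : IsZero ((sysBicomplex P).X a) := by
  rw [IsZero.iff_id_eq_zero]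
  exact HomologicalComplex.hom_ext _ _ fun b => (isZero_sysBicomplex_X_X_of_neg_left P a b ha).eq_of_src _ _

/-- The whole column `Čᵃ,•(P)` is a zero complex for `#ι ≤ a`. [cite: GortzWedhorn2023, Cor. 21.70 (p. 181)] -/
theorem isZero_sysBicomplex_X_of_card_le [Fintype ι] (a : ℤ) (ha : (Fintype.card ι : ℤ) ≤ a) :
    IsZero ((sysBicomplex P).X a) := by
  rw [IsZero.iff_id_eq_zero]
  exact HomologicalComplex.hom_ext _ _ fun b => (isZero_sysBicomplex_X_X_of_card_le_left P a b ha).eq_of_src _ _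

/-! ### §3 Amplitudes: columns, the complex of columns -/

/-- Every column `Čᵃ,•(P)` is concentrated in degrees `≥ 0`. [cite: GortzWedhorn2023, Def. 21.68 (p. 180)] -/
theorem isStrictlyGE_sysBicomplex_X (a : ℤ) : CochainComplex.IsStrictlyGE ((sysBicomplex P).X a) 0 :=
  isStrictlyGE_sysComplex (cochainSystem P a)

/-- Every column `Čᵃ,•(P)` is concentrated in degrees `≤ #κ - 1`. [cite: GortzWedhorn2023, Cor. 21.70 (p. 181)] -/
theorem isStrictlyLE_sysBicomplex_X [Fintype κ] (a : ℤ) :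
    CochainComplex.IsStrictlyLE ((sysBicomplex P).X a) (Fintype.card κ - 1) :=
  isStrictlyLE_sysComplex (cochainSystem P a)

/-- As a cochain complex of columns, `Č•,•(P)` is concentrated in (outer) degrees `≥ 0`. [cite: StacksProject, Tag 0BEC] -/
theorem isStrictlyGE_sysBicomplex : CochainComplex.IsStrictlyGE (sysBicomplex P) 0 :=
  (CochainComplex.isStrictlyGE_iff _ _).2 fun a ha => isZero_sysBicomplex_X_of_neg P a ha

/-- As a cochain complex of columns, `Č•,•(P)` is concentrated in (outer) degrees `≤ #ι - 1`. [cite: StacksProject, Tag 0BEC] -/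
theorem isStrictlyLE_sysBicomplex [Fintype ι] : CochainComplex.IsStrictlyLE (sysBicomplex P) (Fintype.card ι - 1) :=
  (CochainComplex.isStrictlyLE_iff _ _).2 fun a ha => isZero_sysBicomplex_X_of_card_le P a (by omega)

/-! ### §4 Amplitude of the total complex `Tot Č•,•(P)` -/

/-- `(Tot Č•,•(P))ⁿ = 0` for `n < 0`. [cite: StacksProject, Tag 012Z] [cite: Weibel1994, 1.2.6] -/
theorem isZero_sysBicomplex_total_X_of_neg (n : ℤ) (hn : n < 0) :
    IsZero (((sysBicomplex P).total (ComplexShape.up ℤ)).X n) :=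
  isZero_total_X_of_isZero_X_X _ n fun a b hab => by
    rcases lt_or_ge a 0 with ha | ha
    · exact isZero_sysBicomplex_X_X_of_neg_left P a b ha
    · exact isZero_sysBicomplex_X_X_of_neg_right P a b (by omega)

/-- `(Tot Č•,•(P))ⁿ = 0` for `n > #ι + #κ - 2`. [cite: StacksProject, Tag 012Z] [cite: Weibel1994, 1.2.6] -/
theorem isZero_sysBicomplex_total_X_of_lt [Fintype ι] [Fintype κ] (n : ℤ)
    (hn : (Fintype.card ι : ℤ) + Fintype.card κ - 2 < n) :
    IsZero (((sysBicomplex P).total (ComplexShape.up ℤ)).X n) :=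
  isZero_total_X_of_isZero_X_X _ n fun a b hab => by
    rcases lt_or_ge a (Fintype.card ι : ℤ) with ha | ha
    · exact isZero_sysBicomplex_X_X_of_card_le_right P a b (by omega)
    · exact isZero_sysBicomplex_X_X_of_card_le_left P a b ha

/-- **`Tot Č•,•(P)` is concentrated in degrees `≥ 0`.** [cite: StacksProject, Tag 012Z] [cite: StacksProject, Tag 0BEC] -/
theorem isStrictlyGE_sysBicomplex_total :
    CochainComplex.IsStrictlyGE ((sysBicomplex P).total (ComplexShape.up ℤ)) 0 :=
  (CochainComplex.isStrictlyGE_iff _ _).2 fun n hn => isZero_sysBicomplex_total_X_of_neg P n hn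

/-- **`Tot Č•,•(P)` is concentrated in degrees `≤ #ι + #κ - 2`.** [cite: StacksProject, Tag 012Z] [cite: StacksProject, Tag 0BEC] -/
theorem isStrictlyLE_sysBicomplex_total [Fintype ι] [Fintype κ] :
    CochainComplex.IsStrictlyLE ((sysBicomplex P).total (ComplexShape.up ℤ)) ((Fintype.card ι : ℤ) + Fintype.card κ - 2) :=
  (CochainComplex.isStrictlyLE_iff _ _).2 fun n hn => isZero_sysBicomplex_total_X_of_lt P n hn

end OrderedCech

end Literature.Algebra.Homology
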